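import Summits.BirchSwinnertonDyer.Rank1Residual.X2.SplitCellCClassInt
import Summits.BirchSwinnertonDyer.Rank1Residual.X2.MultControlNoPadicTorsion
import HarnessLib

/-!
# O9 ∩ {SPLIT} AT THE CLASS LEVEL with the ÉTALE-ISOGENY SWITCH: `X2c ∩ {split} ⇒ BSD(E,p)` from c2s♭ ∧
# c3s♭ + Mazur's MC on X2b ∩ {split} + PUBLISHED facts + ONE per-class input «some curve of the isogeny
# class carries a prime-to-`p` Manin datum AND has no `ℚ_p`-rational `p`-torsion» — CTL-split is then a
# THEOREM at that curve (cell `bsd-eis`, seat `bsd-eis-cgshw` g8; route `EisensteinPrimes`, crux 4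
# `BSDpOnCellC` = stmt-BirchSwinnertonDyer-19034, line b1, stub `stub_ctl_split`; cgshw MEMO-11; THEOREMS ONLY)

HONEST FRAMING (cell `bsd-eis`, run/shared/lean/pub/bsd-eis/): theorems only; nothing booked; X2 stays
CONSTRUCTION-SHAPED; no label or count moves. `X2/SplitCellCClassInt.lean` (p432213) proves the split
branch of crux 4 from c2s♭ ∧ c3s♭ ∧ CTL-split + crux 3 ∩ split + PUB by running the pointwise road at
the `X₀(N)`-OPTIMAL curve `W₀ ∼ W` (Mazur: Manin constant prime to `p`) and transporting `BSD_p` back by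
Cassels. cgshw MEMO-11 (kit j252590 / j252645): at `W₀` the local `p`-torsion `W₀(ℚ_p)[p]` is NON-ZERO
in 592/592 split X2c window pairs, while the ÉTALE `p`-isogenous curve `W′ = W₀/Φ_ét` has
`W′(ℚ_p)[p] = 0` in 541/592 — and wherever `E(ℚ_p)[p] = 0` the anticyclotomic control theorem is a
THEOREM (`splitControlOnTree_of_cellC_of_noPadicPTorsion`, `X2/MultControlNoPadicTorsion.lean`). This
file runs the same road at ANY curve `W′ ∼ W` supplied with (i) a prime-to-`p` Manin datum and (ii)
`W′(ℚ_p)[p] = 0`, so that CTL-split DISAPPEARS as an input: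

* `bsdp_of_cellC_of_split_of_intResiduals_of_switch` — `∀ W p, CellC W p → split → BSDp W p` from PUB
  (incl. the five cited cohomological facts of the control theorem and Cassels) + (∀ split CellC:
  c2s♭) + (∀ split CellC: c3s♭) + (∀ split CellB: MazurMainConjectureAt) + the SWITCH input
  `hsw : ∀ split CellC pair, ∃ W′ ∼ W, HasPrimeToManinDatum W′ p ∧ W′(ℚ_p)[p] = 0`;
* `bsdp_of_cellC_of_split_of_intResiduals_of_ctlOrSwitch` — the same from the per-pair DISJUNCTION
  «CTL-split ∨ switch» (the shape line b1's reshaped stub takes: true class-by-class from either side).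

The switch input is hypothesis-shaped and per class DECIDABLE by instrument (Tate parameter of the
étale quotient); class-wide it follows from (M1) «an isogeny with étale kernel over ℤ_p pulls the Néron
differential back to a `p`-unit multiple» [PUB, locator owed — lit] for the 541/592 classes with a
torsion-free étale quotient, and FAILS (no such `W′`) for 51/543 classes @3 of the window (MEMO-11 §2
N3), where the genuine torsion case of CTL-split (MEMO-7 §2c (I1)–(I6)) remains.

References: [CastellaEtAl2021] Thm. 5.3.1; [Mazur1978] Cor. 4.1; [MilneADT2006] I.7.3 (Cassels);
[SilvermanAEC2009] VII.6.1, C.14; cgshw MEMO-7, MEMO-11.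
-/

set_option autoImplicit false

noncomputable section

open scoped Classical MatrixGroups ModularForm

open CongruenceSubgroup WeierstrassCurve NumberField IsDedekindDomain Field PowerSeries
  Literature.NumberTheory.EllipticCurves Literature.NumberTheory.EllipticCurves.GreenbergSelmer
  Literature.NumberTheory.EllipticCurves.ModularForms Literature.NumberTheory.QuadraticFields
  Literature.NumberTheory.EllipticCurves.Rank1Residual
  Literature.NumberTheory.EllipticCurves.Rank1Residual.Typed
  Literature.NumberTheory.EllipticCurves.KrizLi2019
  Literature.NumberTheory.EllipticCurves.GreenbergVatsal2000
  Literature.NumberTheory.EllipticCurves.Wuthrich2014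
  Literature.NumberTheory.EllipticCurves.SteinWuthrich2013
  Literature.NumberTheory.GaloisRepresentations Literature.NumberTheory.GaloisCohomology
  Literature.NumberTheory.Automorphic
  Summit.BirchSwinnertonDyer.Rank1Residual.X11b.AcSelmer
  Summit.BirchSwinnertonDyer.Rank1Residual.X11b.Halves
  Summit.BirchSwinnertonDyer.Rank1Residual.X11b

namespace Summit.BirchSwinnertonDyer.Rank1Residual.X2

/-- **X2c ∩ {SPLIT} ⇒ `BSD(E,p)`, CLASS LEVEL, with the ÉTALE-ISOGENY SWITCH — NO CTL-split input, NO
c1s.** For every rank-one X2 pair `(E,p)` at a SPLIT `p`: `BSD(E,p)`, given the PUBLISHED named facts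
(those of `bsdp_of_cellC_of_split_of_manin_of_intResiduals` + the FIVE cited cohomological facts of the
control theorem `hPT`, `hPT2`, `hEP`, `hcd`, `hBr` + Cassels `hCassels`), the two ♭ halves at every
split CellC pair (`h2` c2s♭, `h3` c3s♭), Mazur's MC at every X2b ∩ {split} pair (`hMCB`, crux 3 ∩
split), and the SWITCH input `hsw`: every split CellC pair has an isogenous globally minimal `W′` with a
Manin datum prime to `p` and `W′(ℚ_p)[p] = 0`. Proof: CellC and the split type pass to `W′`
(`CellC.of_isIsogenous`, `IsogenyQuotientLine.hasSplitMultiplicativeReductionAtPrime_of_isIsogenous`);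
CTL-split at `W′` is the THEOREM `splitControlOnTree_of_cellC_of_noPadicPTorsion`; the pointwise road
`bsdp_of_cellC_of_split_of_manin_of_intResiduals` at `W′`; back to `W` by Cassels
(`bsdp_of_isIsogenous_of_bsdp`). CONDITIONAL on every listed binder; nothing booked; no label change.
[cite: CastellaEtAl2021, Thm. 5.3.1] [cite: MilneADT2006, Thm. I.7.3] [cite: Castella2018, Thm. 2.3 (arXiv:1704.06608 p. 5)]
[cite: SilvermanAEC2009, Thm VII.6.1 and C.14] [claim: KellerYin2024, status: under-review] -/
theorem bsdp_of_cellC_of_split_of_intResiduals_of_switch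
    (hGV : lambdaMu_multiplicative_of_gvPar) (hWu : thm16_charIdeal_dvd_multiplicative_of_reducible)
    (hJs : thm61_splitMultiplicative) (hJn : thm61_nonsplitMultiplicative)
    (hHs : exists_isSplitMultCanonical) (hHn : exists_isMultCanonical)
    (hpar : nonempty_modularParametrizationData)
    (hGS : ∀ (W : WeierstrassCurve ℚ) [W.IsElliptic] [W.IsGloballyMinimal] (p : ℕ) [Fact p.Prime],
      greenberg_stevens (W := W) (p := p))
    (hnf : exists_isNewformOf)
    (hPT : ∀ (K : Type) [Field K] [NumberField K], poitouTate_selmerStructure_duality K)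
    (hPT2 : ∀ (K : Type) [Field K] [NumberField K], poitouTate_sha_tateDual K)
    (hEP : ∀ (K : Type) [Field K] [NumberField K] (v : HeightOneSpectrum (𝓞 K)),
      localEulerPoincareCharacteristic (v.adicCompletion K))
    (hcd : fieldCdLE_two_of_numberField)
    (hBr : ∀ (K : Type) [Field K] [NumberField K] (p : ℕ) [Fact p.Prime],
      ZpExtension.decomp_not_le_kerSubgroup_of_isAnticyclotomic K p)
    (hH : hsieh2014_exists_anticyclotomicPAdicLFunction)
    (hGZ : ∀ (N : ℕ) [NeZero N] (W : WeierstrassCurve ℚ) (K : Type) [Field K] [NumberField K],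
      gross_zagier N W K)
    (hKo : ∀ (N : ℕ) [NeZero N] (W : WeierstrassCurve ℚ) (K : Type) [Field K] [NumberField K],
      kolyvagin N W K)
    (hHP : ∀ (N : ℕ) [NeZero N] (W : WeierstrassCurve ℚ) (K : Type) [Field K] [NumberField K],
      heegnerPointComplex_mem_range_map N W K)
    (hGZK : rank_eq_analyticRank_of_analyticRank_le_one)
    (hHL : HoffsteinLuo1997_exists_twist_L_one_ne_zero)
    (hCassels : bsdRHS_eq_of_isIsogenous)
    (h2 : ∀ (W : WeierstrassCurve ℚ) [W.IsElliptic] [W.IsGloballyMinimal] (p : ℕ) [Fact p.Prime],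
      CellC W p → W.HasSplitMultiplicativeReductionAtPrime p → SplitBDPValueOnTreeInt W p)
    (h3 : ∀ (W : WeierstrassCurve ℚ) [W.IsElliptic] [W.IsGloballyMinimal] (p : ℕ) [Fact p.Prime],
      CellC W p → W.HasSplitMultiplicativeReductionAtPrime p → SplitIMCEqOnTreeInt W p)
    (hsw : ∀ (W : WeierstrassCurve ℚ) [W.IsElliptic] [W.IsGloballyMinimal] (p : ℕ) [Fact p.Prime],
      CellC W p → W.HasSplitMultiplicativeReductionAtPrime p →
        ∃ (W' : WeierstrassCurve ℚ) (_ : W'.IsElliptic) (_ : W'.IsGloballyMinimal),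
          IsIsogenous W W' ∧ HasPrimeToManinDatum W' p ∧
            ∀ Q₀ : (W'.baseChange ℚ_[p]).toAffine.Point, p • Q₀ = 0 → Q₀ = 0)
    (hMCB : ∀ (W : WeierstrassCurve ℚ) [W.IsElliptic] [W.IsGloballyMinimal] (p : ℕ) [Fact p.Prime],
      CellB W p → W.HasSplitMultiplicativeReductionAtPrime p → MazurMainConjectureAt W p)
    (W : WeierstrassCurve ℚ) [W.IsElliptic] [W.IsGloballyMinimal] (p : ℕ) [Fact p.Prime]
    (hc : CellC W p) (hs : W.HasSplitMultiplicativeReductionAtPrime p) : BSDp W p := by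
  obtain ⟨W', _, _, hiso, hMan', h0'⟩ := hsw W p hc hs
  have hc' : CellC W' p := CellC.of_isIsogenous hiso hc
  have hs' : W'.HasSplitMultiplicativeReductionAtPrime p :=
    IsogenyQuotientLine.hasSplitMultiplicativeReductionAtPrime_of_isIsogenous hiso hs
  have hCTL' : SplitControlOnTree W' p :=
    splitControlOnTree_of_cellC_of_noPadicPTorsion W' p hGZK hnf hPT hPT2 hEP hcd hBr hc' h0'
  have hb' : BSDp W' p :=
    bsdp_of_cellC_of_split_of_manin_of_intResiduals W' p hGV hWu hJs hJn hHs hHn hpar hGS hnf hH hGZ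
      hKo hHP hGZK hHL hc' hs' hMan' (h2 W' p hc' hs') (h3 W' p hc' hs') hCTL'
      (fun W'' _ _ hB hs'' ↦ hMCB W'' p hB hs'')
  have hmod : hasEntireLFunction_rat := hasEntireLFunction_rat_of_exists_isNewformOf hnf
  exact bsdp_of_isIsogenous_of_bsdp hCassels hGZK hmod W' W hiso.symm_of_charZero p (by rw [hc'.1]) hb'


/-- **X2c ∩ {SPLIT} ⇒ `BSD(E,p)`, CLASS LEVEL, from «CTL-split OR the switch» per pair** — the form line
b1's reshaped stub should take (cgshw MEMO-11 §1): for every split CellC pair EITHER the control theorem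
`SplitControlOnTree W p` (the genuine torsion case, MEMO-7 (I1)–(I6); 51/543 window classes @3 have no
switch) OR the switch datum (an isogenous globally minimal `W′` with a prime-to-`p` Manin datum and
`W′(ℚ_p)[p] = 0`; 541/592 window classes). Proof: move to the `X₀(N)`-optimal curve `W₀ ∼ W`
(`bsdp_of_cellC_of_forall_isIsogenous`: Edixhoven, Mazur, Cassels); at `W₀` case on the disjunction:
CTL ⟹ `bsdp_of_cellC_of_split_of_manin_of_intResiduals` at `W₀`; switch `W′ ∼ W₀` ⟹ the same at `W′`
with CTL the THEOREM `splitControlOnTree_of_cellC_of_noPadicPTorsion`, then Cassels `W′ → W₀`.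
CONDITIONAL on every listed binder; nothing booked; no label change.
[cite: CastellaEtAl2021, Thm. 5.3.1] [cite: Mazur1978, Cor. 4.1] [cite: MilneADT2006, Thm. I.7.3]
[cite: Castella2018, Thm. 2.3 (arXiv:1704.06608 p. 5)] [claim: KellerYin2024, status: under-review] -/
theorem bsdp_of_cellC_of_split_of_intResiduals_of_ctlOrSwitch
    (hGV : lambdaMu_multiplicative_of_gvPar) (hWu : thm16_charIdeal_dvd_multiplicative_of_reducible)
    (hJs : thm61_splitMultiplicative) (hJn : thm61_nonsplitMultiplicative)
    (hHs : exists_isSplitMultCanonical) (hHn : exists_isMultCanonical)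
    (hpar : nonempty_modularParametrizationData)
    (hGS : ∀ (W : WeierstrassCurve ℚ) [W.IsElliptic] [W.IsGloballyMinimal] (p : ℕ) [Fact p.Prime],
      greenberg_stevens (W := W) (p := p))
    (hnf : exists_isNewformOf)
    (hPT : ∀ (K : Type) [Field K] [NumberField K], poitouTate_selmerStructure_duality K)
    (hPT2 : ∀ (K : Type) [Field K] [NumberField K], poitouTate_sha_tateDual K)
    (hEP : ∀ (K : Type) [Field K] [NumberField K] (v : HeightOneSpectrum (𝓞 K)),
      localEulerPoincareCharacteristic (v.adicCompletion K))
    (hcd : fieldCdLE_two_of_numberField)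
    (hBr : ∀ (K : Type) [Field K] [NumberField K] (p : ℕ) [Fact p.Prime],
      ZpExtension.decomp_not_le_kerSubgroup_of_isAnticyclotomic K p)
    (hH : hsieh2014_exists_anticyclotomicPAdicLFunction)
    (hGZ : ∀ (N : ℕ) [NeZero N] (W : WeierstrassCurve ℚ) (K : Type) [Field K] [NumberField K],
      gross_zagier N W K)
    (hKo : ∀ (N : ℕ) [NeZero N] (W : WeierstrassCurve ℚ) (K : Type) [Field K] [NumberField K],
      kolyvagin N W K)
    (hHP : ∀ (N : ℕ) [NeZero N] (W : WeierstrassCurve ℚ) (K : Type) [Field K] [NumberField K],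
      heegnerPointComplex_mem_range_map N W K)
    (hGZK : rank_eq_analyticRank_of_analyticRank_le_one)
    (hHL : HoffsteinLuo1997_exists_twist_L_one_ne_zero)
    (hEd : edixhoven_optimalManinConstant_integral) (hMaz : mazur_not_dvd_maninConstant_of_odd)
    (hCassels : bsdRHS_eq_of_isIsogenous)
    (h2 : ∀ (W : WeierstrassCurve ℚ) [W.IsElliptic] [W.IsGloballyMinimal] (p : ℕ) [Fact p.Prime],
      CellC W p → W.HasSplitMultiplicativeReductionAtPrime p → SplitBDPValueOnTreeInt W p)
    (h3 : ∀ (W : WeierstrassCurve ℚ) [W.IsElliptic] [W.IsGloballyMinimal] (p : ℕ) [Fact p.Prime],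
      CellC W p → W.HasSplitMultiplicativeReductionAtPrime p → SplitIMCEqOnTreeInt W p)
    (hcs : ∀ (W : WeierstrassCurve ℚ) [W.IsElliptic] [W.IsGloballyMinimal] (p : ℕ) [Fact p.Prime],
      CellC W p → W.HasSplitMultiplicativeReductionAtPrime p →
        SplitControlOnTree W p ∨
          ∃ (W' : WeierstrassCurve ℚ) (_ : W'.IsElliptic) (_ : W'.IsGloballyMinimal),
            IsIsogenous W W' ∧ HasPrimeToManinDatum W' p ∧
              ∀ Q₀ : (W'.baseChange ℚ_[p]).toAffine.Point, p • Q₀ = 0 → Q₀ = 0)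
    (hMCB : ∀ (W : WeierstrassCurve ℚ) [W.IsElliptic] [W.IsGloballyMinimal] (p : ℕ) [Fact p.Prime],
      CellB W p → W.HasSplitMultiplicativeReductionAtPrime p → MazurMainConjectureAt W p)
    (W : WeierstrassCurve ℚ) [W.IsElliptic] [W.IsGloballyMinimal] (p : ℕ) [Fact p.Prime]
    (hc : CellC W p) (hs : W.HasSplitMultiplicativeReductionAtPrime p) : BSDp W p := by
  have hmod : hasEntireLFunction_rat := hasEntireLFunction_rat_of_exists_isNewformOf hnf
  refine bsdp_of_cellC_of_forall_isIsogenous hEd hMaz hCassels hpar hnf hGZK W p hc ?_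
  intro W₀ _ _ hiso hc₀ hMan₀
  have hs₀ : W₀.HasSplitMultiplicativeReductionAtPrime p :=
    IsogenyQuotientLine.hasSplitMultiplicativeReductionAtPrime_of_isIsogenous hiso hs
  rcases hcs W₀ p hc₀ hs₀ with hCTL₀ | ⟨W', _, _, hiso', hMan', h0'⟩
  · exact bsdp_of_cellC_of_split_of_manin_of_intResiduals W₀ p hGV hWu hJs hJn hHs hHn hpar hGS hnf hH
      hGZ hKo hHP hGZK hHL hc₀ hs₀ hMan₀ (h2 W₀ p hc₀ hs₀) (h3 W₀ p hc₀ hs₀) hCTL₀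
      (fun W'' _ _ hB hs'' ↦ hMCB W'' p hB hs'')
  · have hc' : CellC W' p := CellC.of_isIsogenous hiso' hc₀
    have hs' : W'.HasSplitMultiplicativeReductionAtPrime p :=
      IsogenyQuotientLine.hasSplitMultiplicativeReductionAtPrime_of_isIsogenous hiso' hs₀
    have hCTL' : SplitControlOnTree W' p :=
      splitControlOnTree_of_cellC_of_noPadicPTorsion W' p hGZK hnf hPT hPT2 hEP hcd hBr hc' h0'
    have hb' : BSDp W' p :=
      bsdp_of_cellC_of_split_of_manin_of_intResiduals W' p hGV hWu hJs hJn hHs hHn hpar hGS hnf hH hGZ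
        hKo hHP hGZK hHL hc' hs' hMan' (h2 W' p hc' hs') (h3 W' p hc' hs') hCTL'
        (fun W'' _ _ hB hs'' ↦ hMCB W'' p hB hs'')
    exact bsdp_of_isIsogenous_of_bsdp hCassels hGZK hmod W' W₀ hiso'.symm_of_charZero p (by rw [hc'.1])
      hb'

end Summit.BirchSwinnertonDyer.Rank1Residual.X2

end
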